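import Literature.Geometry.Riemannian.ThreeShrinkerRicciBarrierChart
import Literature.Geometry.Riemannian.ThreeShrinkerSectionalNonneg
import Literature.Geometry.Riemannian.HamiltonIveyShrinkerAlgebra
import Literature.Geometry.Riemannian.RicciTopEigenvalue
import HarnessLib

/-!
# Step 1 of Munteanu–Wang's compactness theorem on a three-dimensional shrinker: `Ric ≥ c/f`

O. Munteanu, J. Wang, *Positively curved shrinking Ricci solitons are compact*, J. Differential
Geom. 106 (2017), Thm. 2, proof, (2.3)–(2.7) (B. Chow, *Ricci solitons in low dimensions* (2023),
Thm. 4.47, (4.150)–(4.154)), for a complete connected normalised three-dimensional gradient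
shrinker `(N, h, φ)` with `Ric > 0` (then `sect ≥ 0` and `Ric ≥ 0` are theorems:
`ThreeShrinker.two_mul_ricci_le_scalarCurvature`, `ThreeShrinker.ricci_nonneg`):

* **`ThreeShrinker.ricci_ge_div_potential`** — there are `c > 0` and `ρ ≥ max(c, 1)` with
  `(c/φ) h ≤ Ric` on `{φ ≥ ρ}` ("the Ricci curvature decays at most quadratically").

PROOF (as printed, the minimum principle for `u = λ − a(φ⁻¹ + 3φ⁻²)`, `λ = λ_min(Ric)`):
`λ` is continuous and positive (`ricciInf_spec`, `MunteanuWang.exists_pos_le_ricci`); on the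
compact `{φ ≤ ρ₀}` (`ρ₀ ≥ 6`) it is `≥ a₀ > 0`; with the smooth barrier `gb = t⁻¹ + 3t⁻²` on
`[2, ∞)` (`HamiltonIvey.exists_smooth_barrier`) and `a` small, `u = λ − a gb(φ) > 0` on
`{φ ≤ ρ₀}`; if `u < 0` somewhere on `{φ ≥ ρ₀}`, `u` attains a negative minimum `m₀` at an interior
point `p` (`u ≥ −a gb(φ) → 0` at infinity, `φ` proper), where `MunteanuWang.chart_step` gives
`a(gb'(φ)(3/2 − φ) + gb''(φ)(φ − R)) ≤ λ(p) = a gb(φ p) + m₀` while `HamiltonIvey.barrier_ineq`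
(`0 ≤ R ≤ φ`, `φ(p) ≥ 6`) gives `a gb(φ p) ≤ a(gb'(φ)(3/2 − φ) + gb''(φ)(φ − R))`: `m₀ ≥ 0`,
absurd. Hence `λ ≥ a gb(φ) ≥ a/φ` on `{φ ≥ ρ₀}`. Everything is proved.

## References

* O. Munteanu, J. Wang, J. Differential Geom. 106 (2017) = arXiv:1504.07898, Thm. 2. [MunteanuWang2017]
* B. Chow, P. Lu, B. Yang, C. R. Math. 349 (2011) 1265–1267 (the barrier). [MunteanuWang2017]
-/

noncomputable section

set_option maxSynthPendingDepth 3

open Set Filter Module Metric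
open scoped Manifold ContDiff Topology NNReal ENNReal

namespace Literature.Geometry.Riemannian

open Lorentzian Lorentzian.PseudoRiemannianMetric

namespace ThreeShrinker

variable {N : Type} [TopologicalSpace N] [T2Space N] [SecondCountableTopology N]
  [ChartedSpace (EuclideanSpace ℝ (Fin 3)) N] [IsManifold (𝓡 3) ∞ N] [ConnectedSpace N]
  [T3Space N] [MeasurableSpace N] [BorelSpace N]
  (h : PseudoRiemannianMetric (𝓡 3) ∞ (EuclideanSpace ℝ (Fin 3)) (TangentSpace (𝓡 3) : N → Type _))
  [h.HasLeviCivita] (φ : N → ℝ) (hh : h.IsRiemannian)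

/-- **Munteanu–Wang 2017, Thm. 2, step 1 (`n = 3`): on a complete connected normalised
three-dimensional gradient shrinker with `Ric > 0`, the Ricci curvature decays at most
quadratically** — there are `c > 0`, `ρ ≥ max(c, 1)` with `(c/φ(x)) |w|² ≤ Ric_x(w,w)` whenever
`φ(x) ≥ ρ`. See the module docstring for the proof. [cite: MunteanuWang2017, Thm. 2, proof, (2.3)–(2.7)] -/
theorem ricci_ge_div_potential
    (hcpl : ∀ (x : N) (r : ℝ≥0), IsCompact {y : N | h.edist hh x y ≤ r})
    (hφ : ContMDiff (𝓡 3) 𝓘(ℝ, ℝ) ∞ φ)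
    (hsol : ∀ (x : N) (X Y : TangentSpace (𝓡 3) x),
      h.ricci x X Y + h.hessian φ x X Y = (1 / 2 : ℝ) * h.val x X Y)
    (hnorm : ∀ x : N, h.scalarCurvature x + h.gradSq φ x = φ x)
    (hpos : ∀ (x : N) (w : TangentSpace (𝓡 3) x), w ≠ 0 → 0 < h.ricci x w w) :
    ∃ c ρ : ℝ, 0 < c ∧ c ≤ ρ ∧ 1 ≤ ρ ∧ ∀ (x : N) (w : TangentSpace (𝓡 3) x), ρ ≤ φ x →
      c / φ x * h.val x w w ≤ h.ricci x w w := by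
  classical
  -- the empty manifold
  rcases isEmpty_or_nonempty N with hN | ⟨⟨x₀⟩⟩
  · exact ⟨1, 1, one_pos, le_rfl, le_rfl, fun x ↦ (IsEmpty.false x).elim⟩
  -- curvature facts
  have hR0 : ∀ y : N, 0 ≤ h.scalarCurvature y :=
    shrinkerScalarCurvature_nonneg_holds 3 N h φ hh hcpl hφ hsol hnorm
  have hsect := two_mul_ricci_le_scalarCurvature h φ hh hcpl hφ hsol hnorm
  have hRic0 := ricci_nonneg h φ hh hcpl hφ hsol hnorm
  have hgrad : ∀ y, h.gradSq φ y ≤ φ y := fun y ↦ by linarith [hR0 y, hnorm y]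
  have hφ0 : ∀ y, 0 ≤ φ y := fun y ↦ (h.gradSq_nonneg hh φ y).trans (hgrad y)
  have hRφ : ∀ y, h.scalarCurvature y ≤ φ y := fun y ↦ by
    linarith [hnorm y, h.gradSq_nonneg hh φ y]
  have hK : ∀ c : ℝ, IsCompact {y : N | φ y ≤ c} :=
    isCompact_potential_le h φ hh hcpl hφ hsol hnorm hR0
  have h3 : finrank ℝ (EuclideanSpace ℝ (Fin 3)) = 3 := finrank_euclideanSpace_fin
  -- the bottom eigenvalue function `Λ`
  obtain ⟨hΛc, hΛ, hΛge⟩ := ricciInf_spec h hh (by rw [h3]; norm_num)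
  set Λ : N → ℝ := fun y ↦ sInf ((fun w : TangentSpace (𝓡 3) y ↦ h.ricci y w w / h.val y w w) ''
    {w | w ≠ 0}) with hΛdef
  have hΛpos : ∀ y, 0 < Λ y := fun y ↦ by
    obtain ⟨c, hc, hcle⟩ := MunteanuWang.exists_pos_le_ricci h hh y (hpos y)
    exact lt_of_lt_of_le hc (hΛge y c hcle)
  -- the compact core `{φ ≤ ρ₀}` and `a₀ = min Λ` there
  set ρ₀ : ℝ := max 6 (φ x₀) with hρ₀
  have hρ₀6 : (6 : ℝ) ≤ ρ₀ := le_max_left _ _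
  have hx₀K : x₀ ∈ {y : N | φ y ≤ ρ₀} := by
    show φ x₀ ≤ ρ₀; exact le_max_right _ _
  obtain ⟨ym, hymK, hym⟩ := (hK ρ₀).exists_isMinOn ⟨x₀, hx₀K⟩ hΛc.continuousOn
  set a₀ := Λ ym with ha₀
  have ha₀pos : 0 < a₀ := hΛpos ym
  have hcore : ∀ y, φ y ≤ ρ₀ → a₀ ≤ Λ y := fun y hy ↦ hym hy
  -- the smooth barrier `gb` (`= t⁻¹ + 3t⁻²` on `[2,∞)`) and a bound on `[0, ρ₀]`
  obtain ⟨gb, hgbs, hgb, hgb', hgb''⟩ := HamiltonIvey.exists_smooth_barrier'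
  obtain ⟨Bg, hBg⟩ := (isCompact_Icc : IsCompact (Icc (0 : ℝ) ρ₀)).exists_bound_of_continuousOn
    hgbs.continuous.continuousOn
  have hBg0 : 0 ≤ Bg := (norm_nonneg _).trans (hBg 0 ⟨le_rfl, by linarith⟩)
  set a : ℝ := a₀ / (2 * (Bg + 1)) with ha
  have hapos : 0 < a := by positivity
  have haBg : a * Bg < a₀ := by
    rw [ha, div_mul_eq_mul_div, div_lt_iff₀ (by positivity)]
    nlinarith
  -- `u = Λ − a gb(φ)` is positive on the core
  have hucore : ∀ y, φ y ≤ ρ₀ → 0 < Λ y - a * gb (φ y) := fun y hy ↦ by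
    have h1 : ‖gb (φ y)‖ ≤ Bg := hBg (φ y) ⟨hφ0 y, hy⟩
    have h2 : a * gb (φ y) ≤ a * Bg :=
      mul_le_mul_of_nonneg_left ((le_abs_self _).trans (by simpa using h1)) hapos.le
    linarith [hcore y hy]
  -- ### the claim: `a gb(φ) ≤ Λ` on `{φ ≥ ρ₀}`
  have hclaim : ∀ y : N, ρ₀ ≤ φ y → a * gb (φ y) ≤ Λ y := by
    by_contra hneg
    push Not at hneg
    obtain ⟨x₁, hx₁, hux₁⟩ := hneg
    set u : N → ℝ := fun y ↦ Λ y - a * gb (φ y) with hudef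
    have huc : Continuous u := hΛc.sub (continuous_const.mul (hgbs.continuous.comp hφ.continuous))
    have hux₁' : u x₁ < 0 := by simp only [hudef]; linarith
    -- `u ≥ −a gb(φ) = −a(φ⁻¹ + 3φ⁻²) > u x₁` far out
    have hfar : ∀ y, ρ₀ ≤ φ y → -(a * (4 / φ y)) ≤ u y := by
      intro y hy
      have hφ2 : (2 : ℝ) ≤ φ y := by linarith
      have hφpos : 0 < φ y := by linarith
      have hgbv : gb (φ y) = 1 / φ y + 3 / φ y ^ 2 := hgb _ hφ2
      have hle : gb (φ y) ≤ 4 / φ y := by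
        rw [hgbv]
        have h3 : 3 / φ y ^ 2 ≤ 3 / φ y :=
          div_le_div_of_nonneg_left (by norm_num) hφpos (by nlinarith)
        have h4 : 1 / φ y + 3 / φ y = 4 / φ y := by ring
        linarith
      have := hΛpos y
      simp only [hudef]
      nlinarith [mul_le_mul_of_nonneg_left hle hapos.le]
    set T : ℝ := max ρ₀ (4 * a / (-u x₁) + 1) with hT
    have hTbig : ∀ y, T ≤ φ y → u x₁ < u y := by
      intro y hy
      have hyρ : ρ₀ ≤ φ y := le_trans (le_max_left _ _) hy
      have hφpos : 0 < φ y := by linarith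
      have h1 := hfar y hyρ
      have h2 : 4 * a / (-u x₁) < φ y := by
        have := le_max_right ρ₀ (4 * a / (-u x₁) + 1); linarith
      have h3 : a * (4 / φ y) < -u x₁ := by
        rw [div_lt_iff₀ (by linarith)] at h2
        rw [mul_div_assoc', div_lt_iff₀ hφpos]
        linarith
      linarith
    -- the minimum of `u` on the compact `{ρ₀ ≤ φ ≤ T}` is a minimum on `{ρ₀ ≤ φ}`
    have hKT : IsCompact {y : N | ρ₀ ≤ φ y ∧ φ y ≤ T} :=
      (hK T).of_isClosed_subset ((isClosed_le continuous_const hφ.continuous).inter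
        (isClosed_le hφ.continuous continuous_const)) fun y hy ↦ hy.2
    have hx₁T : φ x₁ ≤ T := by
      by_contra hlt
      exact (lt_irrefl _) (hTbig x₁ (le_of_lt (not_le.1 hlt)))
    obtain ⟨p, ⟨hpρ, hpT⟩, hpmin⟩ := hKT.exists_isMinOn ⟨x₁, hx₁, hx₁T⟩ huc.continuousOn
    have hpx₁ : u p ≤ u x₁ := hpmin ⟨hx₁, hx₁T⟩
    have hglob : ∀ y, ρ₀ ≤ φ y → u p ≤ u y := fun y hy ↦ by
      by_cases hyT : φ y ≤ T
      · exact hpmin ⟨hy, hyT⟩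
      · exact hpx₁.trans (hTbig y (le_of_lt (not_le.1 hyT))).le
    have hup : u p < 0 := lt_of_le_of_lt hpx₁ hux₁'
    -- `p` is interior: `ρ₀ < φ p`
    have hpρ' : ρ₀ < φ p := by
      rcases hpρ.lt_or_eq with hlt | heq
      · exact hlt
      · exfalso; linarith [hucore p heq.symm.le]
    -- regional pinching and the chart step at `p`
    set m₀ := u p with hm₀
    have hpin : ∀ y : N, ρ₀ < φ y → ∀ w : TangentSpace (𝓡 3) y,
        (a * gb (φ y) + m₀) * h.val y w w ≤ h.ricci y w w := by
      intro y hy w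
      have h1 : a * gb (φ y) + m₀ ≤ Λ y := by
        have := hglob y hy.le; simp only [hudef] at this ⊢; linarith
      by_cases hw : w = 0
      · subst hw; simp
      · exact (mul_le_mul_of_nonneg_right h1 (hh y w hw).le).trans (hΛ y w)
    have heqΛ : Λ p = a * gb (φ p) + m₀ := by
      show Λ p = a * gb (φ p) + (Λ p - a * gb (φ p)); ring
    have hcs := MunteanuWang.chart_step h hh h3 hφ hsol hnorm hRic0 hsect Λ hΛ p (hΛge p) hgbs
      hpin hpρ' heqΛ
    -- the barrier inequality at `t = φ p ≥ 6`, `0 ≤ R ≤ φ`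
    have hφp6 : 6 ≤ φ p := by linarith
    have hφp2 : 2 ≤ φ p := by linarith
    have hbar := HamiltonIvey.barrier_ineq (φ p) (h.scalarCurvature p) hφp6 (hR0 p) (hRφ p)
    rw [← hgb _ hφp2, ← hgb' _ hφp2, ← hgb'' _ hφp2] at hbar
    have h1 : a * gb (φ p) ≤ Λ p := (mul_le_mul_of_nonneg_left hbar hapos.le).trans hcs
    rw [heqΛ] at h1
    linarith
  -- ### conclusion with `c = min a 1`, `ρ = ρ₀`
  refine ⟨min a 1, ρ₀, lt_min hapos one_pos, (min_le_right _ _).trans (by linarith),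
    by linarith, fun x w hx ↦ ?_⟩
  have hφpos : 0 < φ x := by linarith
  have hφ2 : (2 : ℝ) ≤ φ x := by linarith
  have hgbge : 1 / φ x ≤ gb (φ x) := by
    rw [hgb _ hφ2]
    have : 0 ≤ 3 / φ x ^ 2 := by positivity
    linarith
  by_cases hw : w = 0
  · subst hw; simp
  have hv : 0 < h.val x w w := hh x w hw
  calc min a 1 / φ x * h.val x w w ≤ a * gb (φ x) * h.val x w w := by
        refine mul_le_mul_of_nonneg_right ?_ hv.le
        calc min a 1 / φ x ≤ a / φ x := div_le_div_of_nonneg_right (min_le_left _ _) hφpos.le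
          _ = a * (1 / φ x) := by ring
          _ ≤ a * gb (φ x) := mul_le_mul_of_nonneg_left hgbge hapos.le
    _ ≤ Λ x * h.val x w w := mul_le_mul_of_nonneg_right (hclaim x hx) hv.le
    _ ≤ h.ricci x w w := hΛ x w

end ThreeShrinker

end Literature.Geometry.Riemannian

end
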